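import Summits.BirchSwinnertonDyer.BirchSwinnertonDyer.Theorems.Rank2ObservatoryCubicFieldR21713
import Summits.BirchSwinnertonDyer.BirchSwinnertonDyer.Theorems.Rank2Observatory2DescLinGens
import HarnessLib

/-!
# BirchSwinnertonDyer — rank ≥ 2 observatory: prime elements of the cubic field of `-1 + 19 * X - 12 * X ^ 2 + X ^ 3` (generator addendum `R21713 C1a`)

HONEST FRAMING: per-curve certified theorems and census instruments; no claim on BSD in rank ≥ 2.

Per-FIELD addendum of the KERNEL-2DESC instrument (design `b2b-bsdr2-cert-3/KERNEL-2DESC.md` §9d) for the cubic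
field `K = ℚ(α)`, `α` a root of `-1 + 19 * X - 12 * X ^ 2 + X ^ 3` (`Δ = 21713`, `𝓞_K` a PID; file `Rank2ObservatoryCubicFieldR21713`):
for 1 elements `e = c₀ + c₁α + c₂α² = lin aeval_α c₀ c₁ c₂` it certifies the norm (`MonicCubic.normForm`,
`norm_lin_eq`) and primality (norm `±p`, or norm `±p^f` with the residue certificate of `lin_prime_of_pow`);
(totally real field: the signs at the three real places are certified inline per curve). These elements generate the primes
dividing `F′(θ)` for the census curves with this `2`-division field, `N < 5·10⁵` (data: kit job `j130472` + second
implementation `percurve/identities3r.py`); the per-curve files `Rank2Observatory<label>TwoDescRankTwo.lean`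
reference them by name (`e_<c₀>_<c₁>_<c₂>_norm|prime`, `m` = minus). Generated by
`percurve/gen_addendum4.py`. Sorry-free; axioms `propext`, `Classical.choice`, `Quot.sound`.
[cite: Marcus2018, Ch. 3, Thm. 22] [cite: Cassels1991LecturesEllipticCurves, §15]
-/

-- single-conjunct summit: `Summit.BirchSwinnertonDyer.BirchSwinnertonDyer.…` repeats the name by design
set_option linter.dupNamespace false

noncomputable section

open scoped NumberField

open Literature.NumberTheory.NumberFields Polynomial NumberField

namespace Summit.BirchSwinnertonDyer.BirchSwinnertonDyer.Rank2Observatory.TwoDescCubic.FieldR21713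

/-- `N(19 - 24 * α + 3 * α ^ 2) = -21713` (a prime above `21713`, residue degree `1`; first met at `86852a1`). [folklore] -/
theorem e_19_m24_3_norm : Algebra.norm ℚ ((lin aeval_α 19 (-24) 3 : 𝓞 (CubicField (-12) 19 (-1))) : (CubicField (-12) 19 (-1))) = ((-21713 : ℤ) : ℚ) :=
  norm_lin_eq irreducible aeval_α finrank_eq 19 (-24) 3 (by norm_num [MonicCubic.normForm])

/-- `19 - 24 * α + 3 * α ^ 2` is prime (norm `±21713`). [cite: Marcus2018, Ch. 3, Thm. 22] -/
theorem e_19_m24_3_prime : Prime (lin aeval_α 19 (-24) 3 : 𝓞 (CubicField (-12) 19 (-1))) :=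
  lin_prime_of_prime irreducible aeval_α finrank_eq 19 (-24) 3 (n := -21713)
    (by norm_num [MonicCubic.normForm]) (by norm_num)

end Summit.BirchSwinnertonDyer.BirchSwinnertonDyer.Rank2Observatory.TwoDescCubic.FieldR21713

end
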